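import Mathlib

/-!
# 2-descent identities A1 (duplication), A4 (halving), A2 (sign rule) for `y² = (x - e₁)(x - e₂)(x - e₃)`,
# checked against Mathlib's group law

Blind cell `pub-manin-gamma0`, seat p3; paper reference `proofs/AppA_descent_lead.md`, A1 (used in `proofs/T1_lead.md` §4.5).
For a point `Q = (x₀, y₀)` with `y₀ ≠ 0` on the curve, the abscissa of `2Q` computed with Mathlib's
`WeierstrassCurve.Affine.addX` / `slope` satisfies `x(2Q) - e₁ = r₁(Q)²` with `r₁(Q) = ((x₀ - e₁)² - (e₁ - e₂)(e₁ - e₃)) / (2 y₀)`.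
A2: for `T = (e₂,0)` resp. `(e₁,0)` and `(x₃,y₃) = Q + T` (Mathlib's `addX`/`addY`), `r₁(Q+T) = ∓ r₁(Q)` in cross-multiplied form.
(The statements for the other roots follow by permuting `e₁, e₂, e₃`, the hypotheses being symmetric.)  Only Mathlib is imported;
the `linear_combination` certificates were found by polynomial division and are checked by `ring`.
-/

namespace ManinGamma
namespace Descent

/-- **A1 (duplication).** On `y² = (x-e₁)(x-e₂)(x-e₃)` (i.e. `a₁ = a₃ = 0`, `a₂ = -(e₁+e₂+e₃)`, `a₄ = e₁e₂+e₁e₃+e₂e₃`),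
over a field with `2 ≠ 0`, for a point `(x₀, y₀)` of the curve with `y₀ ≠ 0`:
`x(2Q) - e₁ = (((x₀-e₁)² - (e₁-e₂)(e₁-e₃)) / (2y₀))²`, where `x(2Q) = W.addX x₀ x₀ (W.slope x₀ x₀ y₀ y₀)` is Mathlib's doubling abscissa. -/
theorem addX_self_sub_root {F : Type*} [Field F] [DecidableEq F] (W : WeierstrassCurve.Affine F)
    (e₁ e₂ e₃ x₀ y₀ : F) (h2 : (2 : F) ≠ 0) (ha₁ : W.a₁ = 0) (ha₃ : W.a₃ = 0) (ha₂ : W.a₂ = -(e₁ + e₂ + e₃))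
    (ha₄ : W.a₄ = e₁ * e₂ + e₁ * e₃ + e₂ * e₃)
    (hQ : y₀ ^ 2 = (x₀ - e₁) * (x₀ - e₂) * (x₀ - e₃)) (hy : y₀ ≠ 0) :
    W.addX x₀ x₀ (W.slope x₀ x₀ y₀ y₀) - e₁ = (((x₀ - e₁) ^ 2 - (e₁ - e₂) * (e₁ - e₃)) / (2 * y₀)) ^ 2 := by
  have hne : y₀ ≠ W.negY x₀ y₀ := by
    intro h
    have h' : y₀ = -y₀ - W.a₁ * x₀ - W.a₃ := h
    rw [ha₁, ha₃] at h'
    have : (2 : F) * y₀ = 0 := by linear_combination h'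
    rcases mul_eq_zero.mp this with h0 | h0
    · exact h2 h0
    · exact hy h0
  rw [WeierstrassCurve.Affine.slope_of_Y_ne rfl hne]
  have hden : y₀ - W.negY x₀ y₀ = 2 * y₀ := by
    show y₀ - (-y₀ - W.a₁ * x₀ - W.a₃) = 2 * y₀
    rw [ha₁, ha₃]; ring
  rw [hden]
  show ((3 * x₀ ^ 2 + 2 * W.a₂ * x₀ + W.a₄ - W.a₁ * y₀) / (2 * y₀)) ^ 2
      + W.a₁ * ((3 * x₀ ^ 2 + 2 * W.a₂ * x₀ + W.a₄ - W.a₁ * y₀) / (2 * y₀)) - W.a₂ - x₀ - x₀ - e₁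
      = (((x₀ - e₁) ^ 2 - (e₁ - e₂) * (e₁ - e₃)) / (2 * y₀)) ^ 2
  rw [ha₁, ha₂, ha₄]
  have hy2 : (2 : F) * y₀ ≠ 0 := mul_ne_zero h2 hy
  have hD : ((2 : F) * y₀) ^ 2 ≠ 0 := pow_ne_zero 2 hy2
  rw [zero_mul, sub_zero, zero_mul, add_zero, div_pow, div_pow, eq_div_iff hD, sub_mul, sub_mul, sub_mul, sub_mul,
    div_mul_cancel₀ _ hD]
  linear_combination (4 * (e₂ + e₃ - 2 * x₀)) * hQ

/-- **A4 (halving a 2-torsion point).** With the hypotheses of `addX_self_sub_root`: if `x(2Q) = e₁` (e.g. `2Q = T₁ = (e₁, 0)`),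
then `(x₀ - e₁)² = (e₁ - e₂)(e₁ - e₃)`. -/
theorem sq_eq_of_addX_self_eq_root {F : Type*} [Field F] [DecidableEq F] (W : WeierstrassCurve.Affine F)
    (e₁ e₂ e₃ x₀ y₀ : F) (h2 : (2 : F) ≠ 0) (ha₁ : W.a₁ = 0) (ha₃ : W.a₃ = 0) (ha₂ : W.a₂ = -(e₁ + e₂ + e₃))
    (ha₄ : W.a₄ = e₁ * e₂ + e₁ * e₃ + e₂ * e₃)
    (hQ : y₀ ^ 2 = (x₀ - e₁) * (x₀ - e₂) * (x₀ - e₃)) (hy : y₀ ≠ 0)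
    (h2Q : W.addX x₀ x₀ (W.slope x₀ x₀ y₀ y₀) = e₁) :
    (x₀ - e₁) ^ 2 = (e₁ - e₂) * (e₁ - e₃) := by
  have h := addX_self_sub_root W e₁ e₂ e₃ x₀ y₀ h2 ha₁ ha₃ ha₂ ha₄ hQ hy
  rw [h2Q, sub_self] at h
  have h' : ((x₀ - e₁) ^ 2 - (e₁ - e₂) * (e₁ - e₃)) / (2 * y₀) = 0 := by
    have := h.symm
    exact (pow_eq_zero_iff two_ne_zero).mp this
  rw [div_eq_zero_iff] at h'
  rcases h' with h' | h'
  · exact sub_eq_zero.mp h'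
  · exact absurd h' (mul_ne_zero h2 hy)

/-- **A2 (sign rule, `j ≠ i`), cross-multiplied form.** With `Q = (x₀,y₀)` on `y² = (x-e₁)(x-e₂)(x-e₃)`, `y₀ ≠ 0`, and
`T₂ = (e₂, 0)`, let `(x₃, y₃) = Q + T₂` computed by Mathlib's `addX`/`addY` with `L = slope x₀ e₂ y₀ 0`.  Then
`((x₃-e₁)² - w₁)·(2y₀) = -((x₀-e₁)² - w₁)·(2y₃)` with `w₁ = (e₁-e₂)(e₁-e₃)`, i.e. `r₁(Q+T₂) = -r₁(Q)` whenever `y₃ ≠ 0`. -/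
theorem r_add_twoTorsion_other {F : Type*} [Field F] [DecidableEq F] (W : WeierstrassCurve.Affine F)
    (e₁ e₂ e₃ x₀ y₀ : F) (h2 : (2 : F) ≠ 0) (ha₁ : W.a₁ = 0) (ha₃ : W.a₃ = 0) (ha₂ : W.a₂ = -(e₁ + e₂ + e₃))
    (hQ : y₀ ^ 2 = (x₀ - e₁) * (x₀ - e₂) * (x₀ - e₃)) (hy : y₀ ≠ 0) :
    let L := W.slope x₀ e₂ y₀ 0
    let x₃ := W.addX x₀ e₂ L
    let y₃ := W.addY x₀ e₂ y₀ L
    ((x₃ - e₁) ^ 2 - (e₁ - e₂) * (e₁ - e₃)) * (2 * y₀) = -(((x₀ - e₁) ^ 2 - (e₁ - e₂) * (e₁ - e₃)) * (2 * y₃)) := by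
  intro L x₃ y₃
  have hx : x₀ ≠ e₂ := by
    intro h; rw [h, sub_self, mul_zero, zero_mul] at hQ; exact hy (pow_eq_zero_iff two_ne_zero |>.mp hQ)
  have hx' : x₀ - e₂ ≠ 0 := sub_ne_zero.mpr hx
  have hL : L = y₀ / (x₀ - e₂) := by
    show W.slope x₀ e₂ y₀ 0 = _
    rw [WeierstrassCurve.Affine.slope_of_X_ne hx, sub_zero]
  have hx₃ : x₃ = L ^ 2 + W.a₁ * L - W.a₂ - x₀ - e₂ := rfl
  have hy₃ : y₃ = -(L * (x₃ - x₀) + y₀) - W.a₁ * x₃ - W.a₃ := rfl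
  rw [hy₃, hx₃, hL, ha₁, ha₂, ha₃]
  field_simp
  linear_combination ((-2 : F) * e₁ * e₂ * x₀ * y₀ + e₁ * e₂ ^ 2 * y₀ + e₁ * x₀ ^ 2 * y₀ + (-2 : F) * e₂ * e₃ * x₀ * y₀ + (4 : F) * e₂ * x₀ ^ 2 * y₀ + e₂ ^ 2 * e₃ * y₀ + (-2 : F) * e₂ ^ 2 * x₀ * y₀ + e₃ * x₀ ^ 2 * y₀ + (-2 : F) * x₀ ^ 3 * y₀ + y₀ ^ 3) * hQ

/-- **A2 (sign rule, `j = i`), cross-multiplied form.** Same setting with `T₁ = (e₁, 0)` and `(x₃, y₃) = Q + T₁`: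
`((x₃-e₁)² - w₁)·(2y₀) = ((x₀-e₁)² - w₁)·(2y₃)`, i.e. `r₁(Q+T₁) = r₁(Q)` whenever `y₃ ≠ 0`. -/
theorem r_add_twoTorsion_same {F : Type*} [Field F] [DecidableEq F] (W : WeierstrassCurve.Affine F)
    (e₁ e₂ e₃ x₀ y₀ : F) (h2 : (2 : F) ≠ 0) (ha₁ : W.a₁ = 0) (ha₃ : W.a₃ = 0) (ha₂ : W.a₂ = -(e₁ + e₂ + e₃))
    (hQ : y₀ ^ 2 = (x₀ - e₁) * (x₀ - e₂) * (x₀ - e₃)) (hy : y₀ ≠ 0) :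
    let L := W.slope x₀ e₁ y₀ 0
    let x₃ := W.addX x₀ e₁ L
    let y₃ := W.addY x₀ e₁ y₀ L
    ((x₃ - e₁) ^ 2 - (e₁ - e₂) * (e₁ - e₃)) * (2 * y₀) = ((x₀ - e₁) ^ 2 - (e₁ - e₂) * (e₁ - e₃)) * (2 * y₃) := by
  intro L x₃ y₃
  have hx : x₀ ≠ e₁ := by
    intro h; rw [h, sub_self, zero_mul, zero_mul] at hQ; exact hy (pow_eq_zero_iff two_ne_zero |>.mp hQ)
  have hx' : x₀ - e₁ ≠ 0 := sub_ne_zero.mpr hx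
  have hL : L = y₀ / (x₀ - e₁) := by
    show W.slope x₀ e₁ y₀ 0 = _
    rw [WeierstrassCurve.Affine.slope_of_X_ne hx, sub_zero]
  have hx₃ : x₃ = L ^ 2 + W.a₁ * L - W.a₂ - x₀ - e₁ := rfl
  have hy₃ : y₃ = -(L * (x₃ - x₀) + y₀) - W.a₁ * x₃ - W.a₃ := rfl
  rw [hy₃, hx₃, hL, ha₁, ha₂, ha₃]
  field_simp
  linear_combination ((-2 : F) * e₁ * e₂ * x₀ * y₀ + (-2 : F) * e₁ * e₃ * x₀ * y₀ + (-2 : F) * e₁ * x₀ ^ 2 * y₀ + e₁ ^ 2 * e₂ * y₀ + e₁ ^ 2 * e₃ * y₀ + (4 : F) * e₁ ^ 2 * x₀ * y₀ + (-2 : F) * e₁ ^ 3 * y₀ + e₂ * x₀ ^ 2 * y₀ + e₃ * x₀ ^ 2 * y₀ + y₀ ^ 3) * hQ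

end Descent
end ManinGamma
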